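import Mathlib
import Summits.KontsevichZagierPeriods.Zeta5Search.Elimination.DictStarTop
import HarnessLib

/-!
HONEST FRAMING: systematic search; no irrationality claim unless certified — identities among gen-1's rational
dictionary values and finite bookkeeping only; no number moves; nothing here is a statement about ζ(5).

# gen-1's dictionary PENCIL node holds outright: `DictPencil`

fam-elim (class `elim`), gen 25 (v2 gen 27), E-L26 — sequel to `Elimination/DictStarTop.lean`
(E-L25: `dictStar_holds : DictStar`).

gen-1's node `WedgeDictionaryThreeTerm.DictPencil` (the three-term relation among the dictionary triples
`(Q, P̂_j, P_j)` at `a`, `a + DS`, `a + DS − s_i`, for EVERY base `a` and EVERY slot `i`) was proved on the interior by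
E-L19 (`PencilBridge.dictPencil_at`: `c_i ≥ 1`, `c_i + 1 ≤ c₀`, non-edge sums), and the sharpened descent E-L23b only
consumes it at a slot of maximal value (`pencil_instance_sharp`, whose two residual nodes `DictPencilAxis`,
`DictPencilLevelOne` are theorems: E-L24, cert-1 g5).  The remaining instances — an arbitrary slot `i`, in
particular a ZERO slot `c_i = 0` off the axis — follow from these by LINEAR ALGEBRA and the STAR: as linear forms on
the four values `v(a), v(P), v(P − s_i), v(P − s_k)` (`P = a + DS`),

  `Pencil(a, i) = Pencil(a, k) + Star(P; i, k)`,

because `pencilApex(c, i) − pencilApex(c, k) = P_i(P₀+1−P_i) − P_k(P₀+1−P_k) = (P_i − P_k)(P₀+1−P_i−P_k) =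
starKappa(P, i, k)` and the two fan coefficients agree (`pencil_of_pencil_star`, `pencilApex_add_starKappa`).  The
partner directions `j` are immaterial (`dict_values`: `P̂_j(y) = ρ(y)·(U∧V)(b(y))`, `P_j(y) = ρ(y)·(V∧W)(b(y))` for
every admissible `j`; `dictThreeTerm_partner_free`), and `P − s_k` stays in the region (`regionHyp_slotDown`,
`P_k ≥ 1`).

RESULTS: **`dictPencil_holds : DictPencil`**; `cellPencil_of_explicitPQ' : explicitPQ → CellPencil` (with E-L25's
`cellStar_of_explicitPQ'`: `explicitPQ` implies BOTH cellular families); and, as a closing `example` (v2: the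
named theorem with this exact statement is already in the tree as E-L25's `Elimination.explicitPQ_of_cells`, so it
is not restated — gate `dedup.landed`), gen-1's ORIGINAL descent with both dictionary nodes discharged:
`CellStar → CellPencil → (terminal values) → explicitPQ`
= `explicitPQ_of_terminal hcS dictStar_holds hcP dictPencil_holds hterm`.

What this is NOT: anything about `CellStar`, `CellPencil` (cellular certificate families) or the terminal values; the
class verdict is unchanged (T1 NO / T2 NO / T4 YES).
-/

open Finset

namespace Summit.KontsevichZagierPeriods.Zeta5Search.Elimination

open Summit.KontsevichZagierPeriods.Zeta5Search.WedgeDictionary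
open Literature.NumberTheory.Irrationality.BrownZudilin2022 (bOfA Converges QOf convergenceForms)

/-! ## 1. Partner-freeness and the linear algebra -/

/-- The `P̂`- and `P`-parts of the dictionary do not depend on the admissible partner direction. -/
theorem dictPhat_dictP_partner_free {y : Fin 8 → ℤ} {j j' : ℕ} (h : RegionHyp y j) (h' : RegionHyp y j') :
    dictPhat y j = dictPhat y j' ∧ dictP y j = dictP y j' := by
  obtain ⟨-, h1, h2⟩ := dict_values h
  obtain ⟨-, h1', h2'⟩ := dict_values h'
  exact ⟨h1.trans h1'.symm, h2.trans h2'.symm⟩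

/-- A dictionary three-term relation holds for any admissible partner directions at the three points. -/
theorem dictThreeTerm_partner_free {α β γ : ℚ} {a₀ a₁ a₂ : Fin 8 → ℤ} {j₀ j₁ j₂ j₀' j₁' j₂' : ℕ}
    (h : DictThreeTerm α β γ a₀ a₁ a₂ j₀ j₁ j₂) (r₀ : RegionHyp a₀ j₀) (r₀' : RegionHyp a₀ j₀')
    (r₁ : RegionHyp a₁ j₁) (r₁' : RegionHyp a₁ j₁') (r₂ : RegionHyp a₂ j₂) (r₂' : RegionHyp a₂ j₂') :
    DictThreeTerm α β γ a₀ a₁ a₂ j₀' j₁' j₂' := by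
  obtain ⟨hq, hph, hp⟩ := h
  obtain ⟨e₀, f₀⟩ := dictPhat_dictP_partner_free r₀ r₀'
  obtain ⟨e₁, f₁⟩ := dictPhat_dictP_partner_free r₁ r₁'
  obtain ⟨e₂, f₂⟩ := dictPhat_dictP_partner_free r₂ r₂'
  refine ⟨hq, ?_, ?_⟩
  · rw [← e₀, ← e₁, ← e₂]; exact hph
  · rw [← f₀, ← f₁, ← f₂]; exact hp

/-- **Pencil(i) = Pencil(k) + Star(i, k)** as linear forms: a pencil relation at slot `k` (values at `a, P, P − s_k`)
and the STAR at the apex for the pair `(i, k)` (values at `P, P − s_k, P − s_i`) with opposite `P − s_k` coefficients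
and `β_k + κ = β_i` give the pencil relation at slot `i`. -/
theorem pencil_of_pencil_star {α βk βi κ γk γk' γi : ℚ} {a p pk pi : Fin 8 → ℤ} {j₀ j₁ jk j₂ : ℕ}
    (hP : DictThreeTerm α βk γk a p pk j₀ j₁ jk) (hS : DictThreeTerm κ γk' γi p pk pi j₁ jk j₂)
    (hγ : γk + γk' = 0) (hκ : βk + κ = βi) : DictThreeTerm α βi γi a p pi j₀ j₁ j₂ := by
  obtain ⟨p1, p2, p3⟩ := hP
  obtain ⟨s1, s2, s3⟩ := hS
  refine ⟨?_, ?_, ?_⟩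
  · linear_combination p1 + s1 - (QOf pk : ℚ) * hγ - (QOf p : ℚ) * hκ
  · linear_combination p2 + s2 - dictPhat pk jk * hγ - dictPhat p j₁ * hκ
  · linear_combination p3 + s3 - dictP pk jk * hγ - dictP p j₁ * hκ

/-- The apex coefficients differ by the STAR apex coefficient: `pencilApex(c,k) + starKappa(P,i,k) = pencilApex(c,i)`
at `P = b(a + DS) = (c₀+2; c₁+1, …, c₇+1)`, `c = b(a)`. -/
theorem pencilApex_add_starKappa (a : Fin 8 → ℤ) {i k : ℕ} (hi : i ∈ Icc 1 7) (hk : k ∈ Icc 1 7) :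
    (pencilApex (bOfA a) k : ℚ) + starKappa (bOfA (a + dsUp)) i k = pencilApex (bOfA a) i := by
  obtain ⟨hi1, hi7⟩ := mem_Icc.1 hi
  obtain ⟨hk1, hk7⟩ := mem_Icc.1 hk
  have hi0 : i ≠ 0 := by omega
  have hk0 : k ≠ 0 := by omega
  simp only [pencilApex, starKappa, bOfA_add_dsUp a i hi7, bOfA_add_dsUp a k hk7, bOfA_add_dsUp a 0 (by norm_num),
    if_neg hi0, if_neg hk0]
  push_cast
  ring

/-- The slots of the apex `a + DS` are positive when the base `a` is a region point. -/
theorem slots_pos_dsUp {a : Fin 8 → ℤ} {j : ℕ} (h : RegionHyp a j) : ∀ m ∈ Icc 1 7, 1 ≤ bOfA (a + dsUp) m := by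
  obtain ⟨-, -, hbox, -, -⟩ := h
  intro m hm
  have hm7 : m ≤ 7 := (mem_Icc.1 hm).2
  have hm0 : m ≠ 0 := by have := (mem_Icc.1 hm).1; omega
  have := (hbox m hm).1
  rw [bOfA_add_dsUp a m hm7, if_neg hm0]
  omega

/-! ## 2. `DictPencil` holds -/

/-- **gen-1's `DictPencil` HOLDS** — at every base `a` and every slot `i` (zero slots included): the pencil instance
at a slot of maximal value (`pencil_instance_sharp` with the theorems `dictPencilAxis_holds`,
`dictPencilLevelOne_holds`), moved to the slot `i` by the STAR at the apex (`dictStar_holds`), partner directions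
adjusted by `dict_values`. -/
theorem dictPencil_holds : DictPencil := by
  intro a i j₀ j₁ j₂ hi H₀ H₁ H₂
  have hpos := slots_pos_dsUp H₀
  obtain ⟨k, hk, hPk⟩ := pencil_instance_sharp dictPencilAxis_holds dictPencilLevelOne_holds H₁ hpos
  simp only [add_sub_cancel_right] at hPk
  have Ra : RegionHyp a j₁ := by
    have h := regionHyp_sub_dsUp H₁ hpos
    rwa [add_sub_cancel_right] at h
  have Rk : RegionHyp (a + dsUp + slotDown k) j₁ := regionHyp_slotDown H₁ hk (hpos k hk)
  by_cases hik : i = k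
  · subst hik
    exact dictThreeTerm_partner_free hPk Ra H₀ H₁ H₁ Rk H₂
  · have hS := dictStar_holds (a + dsUp) i k j₁ j₁ j₂ hi hk hik H₁ Rk H₂
    have hP' := dictThreeTerm_partner_free hPk Ra H₀ H₁ H₁ Rk Rk
    exact pencil_of_pencil_star hP' hS (by ring) (pencilApex_add_starKappa a hi hk)

/-! ## 3. Consequences -/

/-- `explicitPQ` alone implies the cellular PENCIL relations (gen-1's `cellPencil_of_explicitPQ` with `DictPencil`
discharged). -/
theorem cellPencil_of_explicitPQ' (h : explicitPQ) : CellPencil := cellPencil_of_explicitPQ h dictPencil_holds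

/- **gen-1's ORIGINAL descent with both dictionary nodes discharged** (shape check only): `explicitPQ` from the two
cellular families and the terminal values (`WedgeDictionaryTerminalDescent.explicitPQ_of_terminal` with
`dictStar_holds`, `dictPencil_holds`).  The NAMED theorem with this statement is E-L25's
`Elimination.explicitPQ_of_cells` (`DictStarTop.lean`, via the sharpened descent); cite that one. -/
example (hcS : CellStar) (hcP : CellPencil)
    (hterm : ∀ (a : Fin 8 → ℤ) (j : ℕ), Terminal a → RegionHyp a j →
      (∀ (c : Fin 8 → ℤ) (j' : ℕ), bOfA c 0 < bOfA a 0 → RegionHyp c j' → ExplicitPQAt c j') → ExplicitPQAt a j) :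
    explicitPQ :=
  explicitPQ_of_terminal hcS dictStar_holds hcP dictPencil_holds hterm

end Summit.KontsevichZagierPeriods.Zeta5Search.Elimination
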